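import Summits.Ventures.PercRepro.Night2ExcessGeneralQ

/-!
# PercRepro — the regime `(q − 1, q − 3)` at every `q`: closed forms, the polynomial target sum, the loss-free
range and the uniform tail `n ≥ 33` (night-2, gen 21)

`Night2ExcessGeneralQ` (gen 20) proved the regime `|E ∖ G| = q − 1`, `kColoops = q − 3` (`ρ = 4`, two top levels)
at every `q ≥ 4` modulo the target sum `1 ≤ genSum n 4 2 c′ (E/4)` whenever the per-basis excess bound `E` is
positive (`localShadowHall_qm1_qm3`).  This file makes every constant explicit and turns that hypothesis into a
polynomial inequality in `(q, n)` (`n = |G| − kColoops M G`):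

* `excessBound_qm1_qm3_eq`: `E_q(n) = 2 ((q³ + 2q² + 9q + 12) − (2q + 3) n) / (q (q + 1)² (n + q − 4))`, so
  `E_q(n) ≤ 0` exactly when `(2q + 3) n ≥ q³ + 2q² + 9q + 12` (`excessBound_qm1_qm3_nonpos_iff`; the gen-20
  prose printed `5q²` for `2q²` — corrected here);
* `cPrimeDGP_qm1_qm3_eq`: `c′ = (4q + 6)/(q (q + 1)²)`; `Ttop_two`: the top two levels hold `n + 1` subsets;
* `PolyIneq q n` := `2 ((q³ + 2q² + 9q + 12) − (2q + 3) n) C(n, 4) ≤ 2 (2q + 3)(n + q − 4) A(n) + q (q + 1)² (n + q − 4)(n + 1)`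
  (`A(n) = Σ_{i=5}^{n−2} C(n, i)`); `one_le_genSum_qm1_qm3_of_polyIneq`: it is exactly «the target sum is `≥ 1`»;
* **`localShadowHall_qm1_qm3_of_polyIneq`**: the regime at `(q, G)` given `PolyIneq q (|G| − kColoops M G)`;
* **`localShadowHall_qm1_qm3_lossFree`**: the regime OUTRIGHT when `(2q + 3)(|G| − kColoops M G) ≥ q³ + 2q² + 9q + 12`
  (the loss-free range: no covering basis loses anything);
* the uniform tail: `Aρt_ge_middle` (`A(n) ≥ C(n, ⌊n/2⌋)`), `two_pow_le_succ_mul_choose_middle`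
  (`2^n ≤ (n + 1) C(n, ⌊n/2⌋)`), `choose_four_sq_le_two_pow` (`81 C(n, 4)² ≤ 16 · 2^n` for `n ≥ 33`),
  `polyIneq_of_overlap` (the A-term alone carries `9 C(n,4) q ≤ 8 A(n)`, the T-term alone the rest, as soon as
  `81 C(n, 4)² ≤ 16 (n + 1) A(n)`) and **`polyIneq_of_ge_33`**: `PolyIneq q n` for every `q ≥ 4`, `n ≥ 33`.
The bounded range `6 ≤ n ≤ 32` is the companion cell files (`Night2GeneralQCells*`).
-/

namespace PercRepro.Shadow

open Finset PerFlat ThmH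

/-! ## Closed forms -/

/-- The per-basis excess bound of the cell `(q − 1, q − 3)` in closed form:
`E_q(n) = 2 ((q³ + 2q² + 9q + 12) − (2q + 3) n) / (q (q + 1)² (n + q − 4))`. -/
theorem excessBound_qm1_qm3_eq {q n : ℕ} (hq : 4 ≤ q) (hn : 6 ≤ n) :
    excessBound q (q - 1) 4 (q - 3) n (aQ q n) (bQ q n) =
      2 * (((q : ℚ) ^ 3 + 2 * (q : ℚ) ^ 2 + 9 * (q : ℚ) + 12) - (2 * (q : ℚ) + 3) * (n : ℚ)) /
        ((q : ℚ) * ((q : ℚ) + 1) ^ 2 * ((n : ℚ) + (q : ℚ) - 4)) := by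
  have hq' : (4 : ℚ) ≤ (q : ℚ) := by exact_mod_cast hq
  have hn' : (6 : ℚ) ≤ (n : ℚ) := by exact_mod_cast hn
  unfold excessBound capDG phiQ aQ bQ
  rw [Nat.cast_sub (by omega : 1 ≤ q), Nat.cast_sub (by omega : 3 ≤ q)]
  push_cast
  have h1 : (q : ℚ) ≠ 0 := by linarith
  have h2 : (q : ℚ) + 1 ≠ 0 := by linarith
  have h3 : (n : ℚ) + (q : ℚ) - 4 ≠ 0 := by linarith
  have h4 : (1 : ℚ) + ((q : ℚ) - 1) ≠ 0 := by linarith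
  field_simp
  ring

/-- `E_q(n) ≤ 0 ⟺ (2q + 3) n ≥ q³ + 2q² + 9q + 12` (`q ≥ 4`, `n ≥ 6`). -/
theorem excessBound_qm1_qm3_nonpos_iff {q n : ℕ} (hq : 4 ≤ q) (hn : 6 ≤ n) :
    excessBound q (q - 1) 4 (q - 3) n (aQ q n) (bQ q n) ≤ 0 ↔
      q ^ 3 + 2 * q ^ 2 + 9 * q + 12 ≤ (2 * q + 3) * n := by
  rw [excessBound_qm1_qm3_eq hq hn]
  have hq' : (4 : ℚ) ≤ (q : ℚ) := by exact_mod_cast hq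
  have hn' : (6 : ℚ) ≤ (n : ℚ) := by exact_mod_cast hn
  have hD : (0 : ℚ) < (q : ℚ) * ((q : ℚ) + 1) ^ 2 * ((n : ℚ) + (q : ℚ) - 4) := by
    have : (0 : ℚ) < (n : ℚ) + (q : ℚ) - 4 := by linarith
    positivity
  rw [div_nonpos_iff]
  constructor
  · rintro (⟨_, hb⟩ | ⟨ha, _⟩)
    · exact absurd hb (not_le.2 hD)
    · have h' : ((q : ℚ) ^ 3 + 2 * (q : ℚ) ^ 2 + 9 * (q : ℚ) + 12) ≤ (2 * (q : ℚ) + 3) * (n : ℚ) := by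
        linarith
      exact_mod_cast h'
  · intro h
    right
    refine ⟨?_, hD.le⟩
    have h' : ((q : ℚ) ^ 3 + 2 * (q : ℚ) ^ 2 + 9 * (q : ℚ) + 12) ≤ (2 * (q : ℚ) + 3) * (n : ℚ) := by
      exact_mod_cast h
    linarith

/-- `c′ = (4q + 6)/(q (q + 1)²)` in the cell `(q − 1, q − 3)` with `m₁ = 2`. -/
theorem cPrimeDGP_qm1_qm3_eq {q : ℕ} (hq : 4 ≤ q) :
    cPrimeDGP q (q - 1) 4 (q - 3) 2 = (4 * (q : ℚ) + 6) / ((q : ℚ) * ((q : ℚ) + 1) ^ 2) := by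
  have hq' : (4 : ℚ) ≤ (q : ℚ) := by exact_mod_cast hq
  have h1 : (q : ℚ) ≠ 0 := by linarith
  have h2 : (q : ℚ) + 1 ≠ 0 := by linarith
  unfold cPrimeDGP capDG reqDGP phiQ
  rw [Nat.cast_sub (by omega : 1 ≤ q), Nat.cast_sub (by omega : 3 ≤ q)]
  push_cast
  have h3 : (1 : ℚ) + ((q : ℚ) - 1) ≠ 0 := by linarith
  have h4 : (2 : ℚ) + ((q : ℚ) - 1) ≠ 0 := by linarith
  field_simp
  ring

/-- The top two levels hold `C(n, n−1) + C(n, n) = n + 1` subsets. -/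
theorem Ttop_two {n : ℕ} (hn : 1 ≤ n) : DGen.Ttop n 2 = n + 1 := by
  unfold DGen.Ttop
  obtain ⟨m, rfl⟩ : ∃ m, n = m + 1 := ⟨n - 1, by omega⟩
  rw [show m + 1 + 1 - 2 = m by omega, Finset.sum_Ico_succ_top (by omega : m ≤ m + 1),
    Finset.sum_Ico_succ_top (by omega : m ≤ m), Finset.Ico_self, Finset.sum_empty, zero_add,
    Nat.choose_self, Nat.choose_succ_self_right]

/-! ## The target sum as a polynomial inequality -/

/-- **The polynomial target-sum inequality of the cell `(q − 1, q − 3)`**: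
`2 ((q³ + 2q² + 9q + 12) − (2q + 3) n) C(n, 4) ≤ 2 (2q + 3)(n + q − 4) A(n) + q (q + 1)² (n + q − 4)(n + 1)`
with `A(n) = Aρt n 4 2 = Σ_{i=5}^{n−2} C(n, i)` (in `ℚ`). -/
def PolyIneq (q n : ℕ) : Prop :=
  2 * (((q : ℚ) ^ 3 + 2 * (q : ℚ) ^ 2 + 9 * (q : ℚ) + 12) - (2 * (q : ℚ) + 3) * (n : ℚ)) * (n.choose 4 : ℚ) ≤
    2 * (2 * (q : ℚ) + 3) * ((n : ℚ) + (q : ℚ) - 4) * (DGen.Aρt n 4 2 : ℚ) +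
      (q : ℚ) * ((q : ℚ) + 1) ^ 2 * ((n : ℚ) + (q : ℚ) - 4) * ((n : ℚ) + 1)

/-- `E · C(n, 4) ≤ c′ A + (n + 1)` is the polynomial inequality (the denominators cleared). -/
theorem excess_mul_choose_le_of_polyIneq {q n : ℕ} (hq : 4 ≤ q) (hn : 6 ≤ n) (hP : PolyIneq q n) :
    excessBound q (q - 1) 4 (q - 3) n (aQ q n) (bQ q n) * (n.choose 4 : ℚ) ≤
      cPrimeDGP q (q - 1) 4 (q - 3) 2 * (DGen.Aρt n 4 2 : ℚ) + ((n : ℚ) + 1) := by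
  rw [excessBound_qm1_qm3_eq hq hn, cPrimeDGP_qm1_qm3_eq hq]
  have hq' : (4 : ℚ) ≤ (q : ℚ) := by exact_mod_cast hq
  have hn' : (6 : ℚ) ≤ (n : ℚ) := by exact_mod_cast hn
  have h1 : (q : ℚ) ≠ 0 := by linarith
  have h2 : (q : ℚ) + 1 ≠ 0 := by linarith
  have h3 : (n : ℚ) + (q : ℚ) - 4 ≠ 0 := by linarith
  have hD : (0 : ℚ) < (q : ℚ) * ((q : ℚ) + 1) ^ 2 * ((n : ℚ) + (q : ℚ) - 4) := by
    have : (0 : ℚ) < (n : ℚ) + (q : ℚ) - 4 := by linarith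
    positivity
  rw [← sub_nonneg]
  have key : (4 * (q : ℚ) + 6) / ((q : ℚ) * ((q : ℚ) + 1) ^ 2) * (DGen.Aρt n 4 2 : ℚ) + ((n : ℚ) + 1) -
      2 * (((q : ℚ) ^ 3 + 2 * (q : ℚ) ^ 2 + 9 * (q : ℚ) + 12) - (2 * (q : ℚ) + 3) * (n : ℚ)) /
        ((q : ℚ) * ((q : ℚ) + 1) ^ 2 * ((n : ℚ) + (q : ℚ) - 4)) * (n.choose 4 : ℚ) =
      (2 * (2 * (q : ℚ) + 3) * ((n : ℚ) + (q : ℚ) - 4) * (DGen.Aρt n 4 2 : ℚ) +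
        (q : ℚ) * ((q : ℚ) + 1) ^ 2 * ((n : ℚ) + (q : ℚ) - 4) * ((n : ℚ) + 1) -
        2 * (((q : ℚ) ^ 3 + 2 * (q : ℚ) ^ 2 + 9 * (q : ℚ) + 12) - (2 * (q : ℚ) + 3) * (n : ℚ)) *
          (n.choose 4 : ℚ)) / ((q : ℚ) * ((q : ℚ) + 1) ^ 2 * ((n : ℚ) + (q : ℚ) - 4)) := by
    field_simp
    ring
  rw [key]
  apply div_nonneg _ hD.le
  unfold PolyIneq at hP
  linarith

/-- **`PolyIneq q n` gives the target sum `≥ 1`** (the hypothesis of `localShadowHall_qm1_qm3`, verbatim). -/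
theorem one_le_genSum_qm1_qm3_of_polyIneq {q n : ℕ} (hq : 4 ≤ q) (hn : 6 ≤ n) (hP : PolyIneq q n)
    (hE : 0 < excessBound q (q - 1) 4 (q - 3) n (aQ q n) (bQ q n)) :
    1 ≤ DGenP.genSum n 4 (q - (q - 1) + 1) (cPrimeDGP q (q - 1) 4 (q - 3) 2)
      (excessBound q (q - 1) 4 (q - 3) n (aQ q n) (bQ q n) / ((4 : ℕ) : ℚ)) := by
  rw [show q - (q - 1) + 1 = 2 by omega]
  have hE4 : (0 : ℚ) < excessBound q (q - 1) 4 (q - 3) n (aQ q n) (bQ q n) / ((4 : ℕ) : ℚ) := by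
    push_cast; positivity
  rw [DGenP.genSum_eq (by omega) (by norm_num) hE4, Ttop_two (by omega)]
  have hC : (0 : ℚ) < (n.choose 4 : ℚ) := by exact_mod_cast Nat.choose_pos (by omega)
  have hden : (0 : ℚ) < ((4 : ℕ) : ℚ) * (excessBound q (q - 1) 4 (q - 3) n (aQ q n) (bQ q n) / ((4 : ℕ) : ℚ)) *
      (n.choose 4 : ℚ) := by positivity
  rw [le_div_iff₀ hden, one_mul]
  have h := excess_mul_choose_le_of_polyIneq hq hn hP
  push_cast
  have e : (4 : ℚ) * (excessBound q (q - 1) 4 (q - 3) n (aQ q n) (bQ q n) / 4) * (n.choose 4 : ℚ) =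
      excessBound q (q - 1) 4 (q - 3) n (aQ q n) (bQ q n) * (n.choose 4 : ℚ) := by ring
  rw [e]
  exact h

variable {α : Type*} [DecidableEq α] {M : Matroid α} [M.Finite]

open scoped Classical in
/-- **THE REGIME `(q − 1, q − 3)` GIVEN THE POLYNOMIAL INEQUALITY**: (LI_G) at a rank-`(q+1)` flat `G` with
`|E ∖ G| = q − 1` and `q − 3` coloops of `M|G` of a simple loopless matroid, provided `PolyIneq q n` holds at
`n = |G| − kColoops M G` (only `n ≥ 6` matters — below it there is no thin member). -/
theorem localShadowHall_qm1_qm3_of_polyIneq {q : ℕ} (hq : 4 ≤ q) {G : Finset α} (hG : G ∈ flatsQ M (q + 1))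
    (hd : (gr M \ G).card = q - 1) (hk : kColoops M G = q - 3)
    (hs : ∀ e ∈ gr M, ∀ f ∈ gr M, e ≠ f → rkN M {e, f} = 2) (hl : ∀ e ∈ gr M, M.Indep {e})
    (hP : 6 ≤ G.card - kColoops M G → PolyIneq q (G.card - kColoops M G)) : LocalShadowHall M q G := by
  by_cases hn6 : 6 ≤ G.card - kColoops M G
  · exact localShadowHall_qm1_qm3 hq hG hd hk hs hl
      (fun hE => one_le_genSum_qm1_qm3_of_polyIneq hq hn6 (hP hn6) hE)
  · push Not at hn6
    have hk' : kColoops M G + 4 = q + 1 := by omega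
    have hd' : (gr M \ G).card ≤ q := by omega
    exact localShadowHall_of_lossFair hG hd'
      (fun B hB => absurd (thin_card_bound (ρ := 4) hG hd (by omega) hk' hB) (by omega))

open scoped Classical in
/-- **THE LOSS-FREE RANGE OF THE REGIME `(q − 1, q − 3)`**: when `(2q + 3)(|G| − kColoops M G) ≥ q³ + 2q² + 9q + 12`
(i.e. `E_q(n) ≤ 0`) no covering basis loses anything and (LI_G) holds outright. -/
theorem localShadowHall_qm1_qm3_lossFree {q : ℕ} (hq : 4 ≤ q) {G : Finset α} (hG : G ∈ flatsQ M (q + 1))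
    (hd : (gr M \ G).card = q - 1) (hk : kColoops M G = q - 3)
    (hs : ∀ e ∈ gr M, ∀ f ∈ gr M, e ≠ f → rkN M {e, f} = 2) (hl : ∀ e ∈ gr M, M.Indep {e})
    (hbig : q ^ 3 + 2 * q ^ 2 + 9 * q + 12 ≤ (2 * q + 3) * (G.card - kColoops M G)) :
    LocalShadowHall M q G := by
  apply localShadowHall_qm1_qm3 hq hG hd hk hs hl
  intro hE
  exfalso
  have hn6 : 6 ≤ G.card - kColoops M G := by nlinarith
  have := (excessBound_qm1_qm3_nonpos_iff hq hn6).2 hbig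
  linarith

/-! ## The uniform tail `n ≥ 33` -/

/-- `A(n) = Σ_{i=5}^{n−2} C(n, i) ≥ C(n, ⌊n/2⌋)` for `n ≥ 10`. -/
theorem Aρt_ge_middle {n : ℕ} (hn : 10 ≤ n) : n.choose (n / 2) ≤ DGen.Aρt n 4 2 := by
  unfold DGen.Aρt
  apply Finset.single_le_sum (f := fun i => n.choose i) (fun i _ => Nat.zero_le _)
  rw [Finset.mem_Ico]
  omega

/-- `2^n ≤ (n + 1) C(n, ⌊n/2⌋)`. -/
theorem two_pow_le_succ_mul_choose_middle (n : ℕ) : 2 ^ n ≤ (n + 1) * n.choose (n / 2) := by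
  rw [← Nat.sum_range_choose n]
  calc ∑ i ∈ Finset.range (n + 1), n.choose i ≤ ∑ _i ∈ Finset.range (n + 1), n.choose (n / 2) :=
        Finset.sum_le_sum (fun i _ => Nat.choose_le_middle i n)
    _ = (n + 1) * n.choose (n / 2) := by rw [Finset.sum_const, Finset.card_range, smul_eq_mul]

/-- `C(n + 1, 4) (n − 3) = (n + 1) C(n, 4)`. -/
theorem choose_four_succ_mul (n : ℕ) : (n + 1).choose 4 * (n - 3) = (n + 1) * n.choose 4 := by
  have h1 := Nat.add_one_mul_choose_eq n 3
  have h2 := Nat.choose_succ_right_eq n 3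
  have h3 : (n + 1).choose 4 * (n - 3) * 4 = (n + 1) * n.choose 4 * 4 := by
    calc (n + 1).choose 4 * (n - 3) * 4 = (n + 1).choose 4 * 4 * (n - 3) := by ring
      _ = (n + 1) * n.choose 3 * (n - 3) := by rw [h1]
      _ = (n + 1) * (n.choose 3 * (n - 3)) := by ring
      _ = (n + 1) * (n.choose 4 * 4) := by rw [h2]
      _ = (n + 1) * n.choose 4 * 4 := by ring
  omega

/-- `81 C(n, 4)² ≤ 16 · 2^n` for every `n ≥ 33` (induction: `C(n+1, 4)² ≤ 2 C(n, 4)²` from `(n+1)² ≤ 2 (n−3)²`). -/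
theorem choose_four_sq_le_two_pow {n : ℕ} (hn : 33 ≤ n) : 81 * (n.choose 4) ^ 2 ≤ 16 * 2 ^ n := by
  induction n, hn using Nat.le_induction with
  | base => decide
  | succ n hn ih =>
    have hrec := choose_four_succ_mul n
    have hsq : (n + 1) ^ 2 ≤ 2 * (n - 3) ^ 2 := by
      obtain ⟨k, rfl⟩ : ∃ k, n = k + 33 := ⟨n - 33, by omega⟩
      rw [show k + 33 - 3 = k + 30 by omega]
      nlinarith
    have key : 81 * ((n + 1).choose 4) ^ 2 * (n - 3) ^ 2 ≤ 16 * 2 ^ (n + 1) * (n - 3) ^ 2 := by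
      calc 81 * ((n + 1).choose 4) ^ 2 * (n - 3) ^ 2 = 81 * ((n + 1).choose 4 * (n - 3)) ^ 2 := by ring
        _ = 81 * ((n + 1) * n.choose 4) ^ 2 := by rw [hrec]
        _ = (81 * (n.choose 4) ^ 2) * (n + 1) ^ 2 := by ring
        _ ≤ (16 * 2 ^ n) * (2 * (n - 3) ^ 2) := Nat.mul_le_mul ih hsq
        _ = 16 * 2 ^ (n + 1) * (n - 3) ^ 2 := by ring
    have hpos : 0 < (n - 3) ^ 2 := by
      have : 0 < n - 3 := by omega
      positivity
    exact Nat.le_of_mul_le_mul_right key hpos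

/-- **The overlap argument**: `PolyIneq q n` whenever `81 C(n, 4)² ≤ 16 (n + 1) A(n)` (`q ≥ 4`, `n ≥ 6`) —
for `9 C(n,4) q ≤ 8 A(n)` the `A`-term alone carries the left side, otherwise the `T`-term alone does. -/
theorem polyIneq_of_overlap {q n : ℕ} (hq : 4 ≤ q) (hn : 6 ≤ n)
    (hov : 81 * (n.choose 4 : ℚ) ^ 2 ≤ 16 * ((n : ℚ) + 1) * (DGen.Aρt n 4 2 : ℚ)) : PolyIneq q n := by
  unfold PolyIneq
  have hx4 : (4 : ℚ) ≤ (q : ℚ) := by exact_mod_cast hq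
  have hm6 : (6 : ℚ) ≤ (n : ℚ) := by exact_mod_cast hn
  have hx0 : (0 : ℚ) ≤ (q : ℚ) := by linarith
  have hA0 : (0 : ℚ) ≤ (DGen.Aρt n 4 2 : ℚ) := by positivity
  have hC0 : (0 : ℚ) < (n.choose 4 : ℚ) := by exact_mod_cast Nat.choose_pos (by omega)
  -- `q³ + 2q² + 9q + 12 ≤ (9/4) q³` for `q ≥ 4`
  have hN0 : (q : ℚ) ^ 3 + 2 * (q : ℚ) ^ 2 + 9 * (q : ℚ) + 12 ≤ 9 / 4 * (q : ℚ) ^ 3 := by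
    nlinarith [mul_nonneg (by linarith : (0 : ℚ) ≤ (q : ℚ) - 4)
      (by positivity : (0 : ℚ) ≤ 5 / 4 * (q : ℚ) ^ 2 + 3 * (q : ℚ) + 3)]
  have hLHS : 2 * (((q : ℚ) ^ 3 + 2 * (q : ℚ) ^ 2 + 9 * (q : ℚ) + 12) - (2 * (q : ℚ) + 3) * (n : ℚ)) *
      (n.choose 4 : ℚ) ≤ 9 / 2 * (q : ℚ) ^ 3 * (n.choose 4 : ℚ) := by
    have h1 : ((q : ℚ) ^ 3 + 2 * (q : ℚ) ^ 2 + 9 * (q : ℚ) + 12) - (2 * (q : ℚ) + 3) * (n : ℚ) ≤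
        9 / 4 * (q : ℚ) ^ 3 := by nlinarith
    nlinarith
  have hnq : (0 : ℚ) ≤ (n : ℚ) + (q : ℚ) - 4 := by linarith
  have hT0 : (0 : ℚ) ≤ (q : ℚ) * ((q : ℚ) + 1) ^ 2 * ((n : ℚ) + (q : ℚ) - 4) * ((n : ℚ) + 1) := by
    have h1 : (0 : ℚ) ≤ (q : ℚ) * ((q : ℚ) + 1) ^ 2 := by positivity
    have h2 : (0 : ℚ) ≤ (n : ℚ) + 1 := by linarith
    exact mul_nonneg (mul_nonneg h1 hnq) h2
  have hA0' : (0 : ℚ) ≤ 2 * (2 * (q : ℚ) + 3) * ((n : ℚ) + (q : ℚ) - 4) * (DGen.Aρt n 4 2 : ℚ) := by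
    have h1 : (0 : ℚ) ≤ 2 * (2 * (q : ℚ) + 3) := by linarith
    exact mul_nonneg (mul_nonneg h1 hnq) hA0
  by_cases hcase : 9 * (n.choose 4 : ℚ) * (q : ℚ) ≤ 8 * (DGen.Aρt n 4 2 : ℚ)
  · -- the `A`-term alone: `(9/2) q³ C ≤ 4 q² A ≤ 2 (2q+3)(n+q−4) A`
    have h1 : 9 / 2 * (q : ℚ) ^ 3 * (n.choose 4 : ℚ) ≤ 4 * (q : ℚ) ^ 2 * (DGen.Aρt n 4 2 : ℚ) := by
      have hq2 : (0 : ℚ) ≤ (q : ℚ) ^ 2 := by positivity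
      have := mul_le_mul_of_nonneg_left hcase hq2
      nlinarith
    have h2 : 4 * (q : ℚ) ^ 2 ≤ 2 * (2 * (q : ℚ) + 3) * ((n : ℚ) + (q : ℚ) - 4) := by nlinarith
    have h3 : 4 * (q : ℚ) ^ 2 * (DGen.Aρt n 4 2 : ℚ) ≤
        2 * (2 * (q : ℚ) + 3) * ((n : ℚ) + (q : ℚ) - 4) * (DGen.Aρt n 4 2 : ℚ) :=
      mul_le_mul_of_nonneg_right h2 hA0
    linarith
  · -- the `T`-term alone: `8 A < 9 C q` and the overlap give `9 C < 2 (n+1) q`, so `(9/2) q³ C < (n+1) q⁴ ≤ T`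
    push Not at hcase
    have h1 : 9 * (n.choose 4 : ℚ) < 2 * ((n : ℚ) + 1) * (q : ℚ) := by
      have h0 : 81 * (n.choose 4 : ℚ) ^ 2 < 18 * ((n : ℚ) + 1) * (n.choose 4 : ℚ) * (q : ℚ) := by
        have : (0 : ℚ) < 2 * ((n : ℚ) + 1) := by linarith
        nlinarith
      nlinarith
    have h2 : 9 / 2 * (q : ℚ) ^ 3 * (n.choose 4 : ℚ) ≤ ((n : ℚ) + 1) * (q : ℚ) ^ 4 := by
      have hq3 : (0 : ℚ) ≤ (q : ℚ) ^ 3 := by positivity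
      have := mul_le_mul_of_nonneg_left h1.le hq3
      nlinarith
    have h3 : ((n : ℚ) + 1) * (q : ℚ) ^ 4 ≤
        (q : ℚ) * ((q : ℚ) + 1) ^ 2 * ((n : ℚ) + (q : ℚ) - 4) * ((n : ℚ) + 1) := by
      have e1 : (q : ℚ) ^ 2 ≤ ((q : ℚ) + 1) ^ 2 := by nlinarith
      have e2 : (q : ℚ) ≤ (n : ℚ) + (q : ℚ) - 4 := by linarith
      have e3 : (q : ℚ) ^ 4 ≤ (q : ℚ) * ((q : ℚ) + 1) ^ 2 * ((n : ℚ) + (q : ℚ) - 4) := by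
        calc (q : ℚ) ^ 4 = (q : ℚ) * (q : ℚ) ^ 2 * (q : ℚ) := by ring
          _ ≤ (q : ℚ) * ((q : ℚ) + 1) ^ 2 * ((n : ℚ) + (q : ℚ) - 4) := by
            apply mul_le_mul (mul_le_mul_of_nonneg_left e1 hx0) e2 hx0
            positivity
      have h4 : (0 : ℚ) ≤ (n : ℚ) + 1 := by linarith
      nlinarith [mul_le_mul_of_nonneg_left e3 h4]
    linarith

/-- **`PolyIneq q n` for every `q ≥ 4` and `n ≥ 33`** (the uniform tail): `81 C(n,4)² ≤ 16 · 2^n ≤ 16 (n+1) C(n, ⌊n/2⌋)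
≤ 16 (n+1) A(n)`. -/
theorem polyIneq_of_ge_33 {q n : ℕ} (hq : 4 ≤ q) (hn : 33 ≤ n) : PolyIneq q n := by
  apply polyIneq_of_overlap hq (by omega)
  have h1 := choose_four_sq_le_two_pow hn
  have h2 := two_pow_le_succ_mul_choose_middle n
  have h3 := Aρt_ge_middle (by omega : 10 ≤ n)
  have h4 : 81 * (n.choose 4) ^ 2 ≤ 16 * (n + 1) * DGen.Aρt n 4 2 := by
    calc 81 * (n.choose 4) ^ 2 ≤ 16 * 2 ^ n := h1
      _ ≤ 16 * ((n + 1) * n.choose (n / 2)) := Nat.mul_le_mul_left _ h2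
      _ ≤ 16 * ((n + 1) * DGen.Aρt n 4 2) := Nat.mul_le_mul_left _ (Nat.mul_le_mul_left _ h3)
      _ = 16 * (n + 1) * DGen.Aρt n 4 2 := by ring
  exact_mod_cast h4

end PercRepro.Shadow
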